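import Summits.QuantumFields.YangMills.Theorems.BalabanUVNodesN15ColouredDirichletCovariance
import Summits.QuantumFields.YangMills.Theorems.BalabanUVNodesN15ColouredFluctuationCovarianceDecay
import HarnessLib

/-!
# N15 = NE2 — PROGRAMME Ð (Ð-2): ★★ THE UNIFORM EXPONENTIAL DECAY OF THE COLOURED (2.156) COVARIANCE WITH DIRICHLET ELIMINATION `C_S(C_Sᵀ(Δ^{(n)}⊗1 + P)C_S)⁻¹C_Sᵀ` — ONE `(c, δ)` FOR EVERY REGION
# (dag-n15-a g30, programme Ð «Dirichlet», FILE (Ð-2); node N15 = NE2; `--supports stmt-QuantumFields-27366 --as helper`, count-neutral; 0 def, one theorem)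

WHY ∕ HOW.  (Ð-1) supplied the coloured Dirichlet objects (`elimCS`, `covCS`, `fdistS`) with (L-1)'s letters and positivity rebuilt ON an arbitrary sub-family `S` of the remaining variables
(the Λ-bonds of a Dirichlet region `Λ = B(Λ′₀) ⊂ T`, [B9] §E ∕ [B6] (2.154)–(2.156)).  Here (L-2)'s decay proof is run on the kept variables: the constants `(c, δ)` are (L-2)'s — chosen from
`(d, L, δ_P, N_c)` BEFORE the torus, the region, the colour type, the level and the perturbation (threshold `epsCovC` of (L-2) reused by name).  The η-RATE is the sequel (Ð-3).
Honest label: bookkeeping over landed rows; NO layer of NE2 proved here; no count. [cite: Balaban1985BackgroundPropagators, §E pp.427–428, Thm 3.15 p.432; Balaban1984PropagatorsII, (2.152)–(2.157) pp.249–250; CombesThomas1973, §II (mechanism)]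
-/

noncomputable section

open scoped BigOperators Matrix Kronecker

namespace Summit.QuantumFields.YangMills.BalabanUVNodes.N15.UnitLayerBgCol

open Literature.MathematicalPhysics.QuantumFieldTheory.Balaban1983to89
open Literature.MathematicalPhysics.QuantumFieldTheory.King1986 (exp_decay_mono)
open Literature.MathematicalPhysics.QuantumFieldTheory.Balaban1983to89.B5Prop11Plancherel (Tor fine)
open Literature.MathematicalPhysics.QuantumFieldTheory.Balaban1983to89.B6Lemma24Torus (pbox)
open Literature.MathematicalPhysics.QuantumFieldTheory.Balaban1983to89.B6Cov2156Torus (freeT elimT deltaPol one_le_M gamma2153 gamma2153_pos)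
open Literature.MathematicalPhysics.QuantumFieldTheory.Balaban1983to89.B4Sect5Proof (latticeConst latticeConst_nonneg)
open Literature.MathematicalPhysics.QuantumFieldTheory.Balaban1983to89.QGQInverse (Coercive isUnit_of_coercive)
open Summit.QuantumFields.YangMills.BalabanUVNodes.N15.UnitLayerBg (abs_inv_le_of_coercive_decay)

variable {d : ℕ} (L : ℕ)

/-! ## ★★ The decay of the coloured Dirichlet covariance, uniform in the torus, the region, the colour type, the level and the perturbation -/

section Decay

variable (d) in
/-- ★★ **THE DECAY OF THE COLOURED (2.156) COVARIANCE WITH DIRICHLET ELIMINATION, UNIFORM IN THE REGION.**  Let `d ≥ 1`, `L ≥ 1`, `δ_P > 0`, a colour bound `N_c`.  There are `c, δ > 0`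
(depending on `d, L, δ_P, N_c` only — the SAME as (L-2)'s, with the SAME threshold `epsCovC`) such that for EVERY unit torus (`L ∣ M_i`), EVERY sub-family `S` of b06's remaining variables (in
particular the Λ-bonds `lamFree L M Λ'₀` of EVERY region `Λ = B(Λ′₀)`), EVERY colour type `ι` with `|ι| ≤ N_c`, EVERY level `n ≥ 1` and EVERY coloured perturbation `|P(p,q)| ≤ ε·e^{−δ_P·cdist(p,q)}`
with `0 ≤ ε ≤ epsCovC d L N_c δ_P`:  `C_Sᵀ(Δ^{(n)}⊗1 + P)C_S` is invertible and `|covCS L M ι S hS (Δ^{(n)} ⊗ₖ 1 + P)(p,q)| ≤ c·e^{−δ·cdist(p,q)}`.  Chain = (L-2)'s verbatim on the kept variables: entry decay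
of `Δ^{(n)}⊗1 + P` ((G) `kernelDecay166_col`), (Ð-1) `abs_sandwichTS_le`, (Ð-1) `coercive_sandwichCS` (`γ′₀∕2`), V-B `abs_inv_le_of_coercive_decay` (finite Combes–Thomas, pseudo-metric `fdistS`),
(Ð-1) `abs_sandwichS_le`.  This is [B9] Thm 3.15's «constants depending on d and L only» for the Dirichlet region at the level of the model's coloured unit form. [cite: Balaban1985BackgroundPropagators, §E pp.427–428, Thm 3.15 (3.187) p.432; Balaban1984PropagatorsII, (2.152)–(2.157) pp.249–250; CombesThomas1973, §II (mechanism)] -/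
theorem covCS_decay (hd : 1 ≤ d) (hL : 1 ≤ L) (Nc : ℕ) {δP : ℝ} (hδP : 0 < δP) :
    ∃ c δ : ℝ, 0 < c ∧ 0 < δ ∧
      ∀ (M : Fin (d + 1) → ℕ) [∀ μ, NeZero (M μ)], (∀ μ, L ∣ M μ) → ∀ (S : Finset (B4.Idx (pbox M) (d + 1))) (hS : S ⊆ freeT L M),
      ∀ (ι : Type) [Fintype ι] [DecidableEq ι], Fintype.card ι ≤ Nc → ∀ (n : ℕ), 1 ≤ n → ∀ (P : Matrix (B4.Idx (pbox M) (d + 1) × ι) (B4.Idx (pbox M) (d + 1) × ι) ℝ) (ε : ℝ), 0 ≤ ε → ε ≤ epsCovC d L Nc δP →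
        (∀ p q, |P p q| ≤ ε * Real.exp (-(δP * cdist M ι p q))) →
        IsUnit ((elimCS L M ι S hS)ᵀ * (deltaPol M n ⊗ₖ (1 : Matrix ι ι ℝ) + P) * elimCS L M ι S hS).det ∧
        ∀ p q, |covCS L M ι S hS (deltaPol M n ⊗ₖ (1 : Matrix ι ι ℝ) + P) p q| ≤ c * Real.exp (-(δ * cdist M ι p q)) := by
  have hL0 : 0 < L := hL
  have hLr : (1 : ℝ) ≤ (L : ℝ) := by exact_mod_cast hL
  obtain ⟨c₀, δ₀, hc₀, hδ₀, hK⟩ := kernelDecay166_col d (by omega)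
  have hγ := gamma2153_pos (d := d + 1) (by omega) hL
  set γ := gamma2153 (d + 1) L with hγdef
  set ε₀ := epsCovC d L Nc δP with hε₀def
  have hε₀ : 0 < ε₀ := epsCovC_pos L hL Nc hδP
  -- the common decay rate of `A = Δ⊗1 + P` and the row-sum constant
  set κ := min δ₀ δP with hκdef
  have hκ : 0 < κ := lt_min hδ₀ hδP
  have hκδ₀ : κ ≤ δ₀ := min_le_left _ _
  have hκP : κ ≤ δP := min_le_right _ _
  set VP : ℝ := (Nc : ℝ) * (((d : ℝ) + 1) * latticeConst (d + 1) δP) with hVPdef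
  have hVP0 : 0 ≤ VP := by have := latticeConst_nonneg (d + 1) hδP.le; positivity
  have hε₀V : ε₀ * VP ≤ γ / 2 := by
    rw [hε₀def, epsCovC, ← hγdef, ← hVPdef, div_mul_eq_mul_div, div_le_iff₀ (by positivity)]
    nlinarith [hγ.le]
  -- the sandwich's decay constant and the Combes–Thomas rates on the free variables
  set cA : ℝ := c₀ + ε₀ with hcAdef
  have hcA : 0 ≤ cA := by positivity
  set cW : ℝ := 4 * cA * Real.exp (2 * κ * ((L : ℝ) - 1)) with hcWdef
  have hcW : 0 ≤ cW := by positivity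
  set τ : ℝ := κ / 2 with hτdef
  have hτ : 0 < τ := by positivity
  set V₄ : ℝ := (Nc : ℝ) * (((d : ℝ) + 1) * latticeConst (d + 1) (κ / 4)) with hV₄def
  have hV₄0 : 0 ≤ V₄ := by have := latticeConst_nonneg (d + 1) (show 0 ≤ κ / 4 by positivity); positivity
  set κ' : ℝ := min (κ / 4) (γ * τ / (4 * (cW * V₄ + 1))) with hκ'def
  have hκ' : 0 < κ' := lt_min (by positivity) (by positivity)
  have hκ'le : κ' ≤ κ / 4 := min_le_left _ _
  have hsmall : cW * V₄ * κ' / τ ≤ γ / 4 := by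
    have h1 : κ' ≤ γ * τ / (4 * (cW * V₄ + 1)) := min_le_right _ _
    rw [div_le_iff₀ hτ]
    have h2 : cW * V₄ * κ' ≤ (cW * V₄ + 1) * κ' := by nlinarith [hκ'.le]
    have h3 : (cW * V₄ + 1) * κ' ≤ γ * τ / 4 := by
      have := mul_le_mul_of_nonneg_left h1 (by positivity : (0 : ℝ) ≤ cW * V₄ + 1)
      calc (cW * V₄ + 1) * κ' ≤ (cW * V₄ + 1) * (γ * τ / (4 * (cW * V₄ + 1))) := this
        _ = γ * τ / 4 := by field_simp
    linarith
  refine ⟨((L : ℝ) ^ (d + 1)) ^ 2 * (γ / 4)⁻¹ * Real.exp (2 * κ' * ((L : ℝ) - 1)) + 1, κ', by positivity, hκ', ?_⟩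
  intro M _ hLM S hS ι _ _ hι n hn P ε hε hεle hP
  have hιr : (Fintype.card ι : ℝ) ≤ Nc := by exact_mod_cast hι
  have hd0 : (0 : ℝ) < (d : ℝ) + 1 := by positivity
  -- row sums on the coloured bonds and free variables
  have hW : ∀ {a : ℝ}, 0 < a → ∀ p : B4.Idx (pbox M) (d + 1) × ι, ∑ q, Real.exp (-(a * cdist M ι p q)) ≤ (Nc : ℝ) * (((d : ℝ) + 1) * latticeConst (d + 1) a) :=
    fun {a} ha p => (colSum_le M ι ha p).trans (mul_le_mul_of_nonneg_right hιr (mul_nonneg hd0.le (latticeConst_nonneg (d + 1) ha.le)))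
  have hWF : ∀ {a : ℝ}, 0 < a → ∀ g : S × ι, ∑ g', Real.exp (-(a * fdistS M ι S g g')) ≤ (Nc : ℝ) * (((d : ℝ) + 1) * latticeConst (d + 1) a) :=
    fun {a} ha g => (fsumS_le ha g).trans (mul_le_mul_of_nonneg_right hιr (mul_nonneg hd0.le (latticeConst_nonneg (d + 1) ha.le)))
  -- positivity
  have hεV : ε * VP ≤ γ / 2 := (mul_le_mul_of_nonneg_right hεle hVP0).trans hε₀V
  have hco : Coercive ((elimCS L M ι S hS)ᵀ * (deltaPol M n ⊗ₖ (1 : Matrix ι ι ℝ) + P) * elimCS L M ι S hS) (γ - ε * VP) :=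
    coercive_sandwichCS hd hL hLM hn hε hVP0 hP (fun p => by rw [hVPdef]; exact hW hδP p) (by linarith)
  have hco' : Coercive ((elimCS L M ι S hS)ᵀ * (deltaPol M n ⊗ₖ (1 : Matrix ι ι ℝ) + P) * elimCS L M ι S hS) (γ / 2) := fun x => by
    have h := hco x
    have hx : 0 ≤ x ⬝ᵥ x := Literature.LinearAlgebra.Matrix.dotProduct_self_nonneg_real x
    nlinarith
  have hunit : IsUnit ((elimCS L M ι S hS)ᵀ * (deltaPol M n ⊗ₖ (1 : Matrix ι ι ℝ) + P) * elimCS L M ι S hS).det :=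
    (Matrix.isUnit_iff_isUnit_det _).mp (isUnit_of_coercive (by positivity) hco')
  refine ⟨hunit, fun p q => ?_⟩
  -- entry decay of `A = Δ⊗1 + P` at rate κ, constant `c₀ + ε₀`
  have hA : ∀ p q, |(deltaPol M n ⊗ₖ (1 : Matrix ι ι ℝ) + P) p q| ≤ cA * Real.exp (-(κ * cdist M ι p q)) := fun p q => by
    rw [Matrix.add_apply, hcAdef, add_mul]
    refine (abs_add_le _ _).trans (add_le_add ?_ ?_)
    · exact (hK M ι n hn p q).trans (exp_decay_mono hc₀.le hκδ₀ (cdist_nonneg M ι p q))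
    · exact ((hP p q).trans (exp_decay_mono hε hκP (cdist_nonneg M ι p q))).trans
        (mul_le_mul_of_nonneg_right hεle (Real.exp_nonneg _))
  -- the sandwich `W` decays at rate κ on the free variables
  have hWdec := abs_sandwichTS_le (ι := ι) (hS := hS) hL0 hLM hcA hκ.le hA
  -- Combes–Thomas: `W⁻¹` decays at rate κ′ (row sums at rate `κ − κ′ − τ ≥ κ/4`)
  have hrate : κ / 4 ≤ κ - κ' - τ := by rw [hτdef]; linarith
  have hV' : ∀ g : S × ι, ∑ g', Real.exp (-((κ - κ' - τ) * fdistS M ι S g g')) ≤ V₄ := fun g => by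
    refine (Finset.sum_le_sum fun g' _ => Real.exp_le_exp.mpr ?_).trans (by rw [hV₄def]; exact hWF (by positivity) g)
    have := cdist_nonneg M ι ((g.1 : B4.Idx (pbox M) (d + 1)), g.2) ((g'.1 : B4.Idx (pbox M) (d + 1)), g'.2)
    rw [fdistS_eq]; nlinarith
  have hlt : cW * V₄ * κ' / τ < γ / 2 := by linarith
  have hinv := abs_inv_le_of_coercive_decay (fdistS M ι S) (fun g g' => cdist_nonneg M ι _ _) (fun g g' => cdist_comm M ι _ _) (fun g => cdist_self M ι _)
    (fun g g' g'' => cdist_triangle M ι _ _ _) _ hco' hcW hκ'.le hτ hWdec hV' hlt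
  -- the constant of the inverse
  have hgap : (γ / 4)⁻¹ ≥ (γ / 2 - cW * V₄ * κ' / τ)⁻¹ := by
    apply inv_anti₀ (by positivity); linarith
  have hX : ∀ g g', |((elimCS L M ι S hS)ᵀ * (deltaPol M n ⊗ₖ (1 : Matrix ι ι ℝ) + P) * elimCS L M ι S hS)⁻¹ g g'| ≤ (γ / 4)⁻¹ * Real.exp (-(κ' * fdistS M ι S g g')) :=
    fun g g' => (hinv g g').trans (mul_le_mul_of_nonneg_right hgap (Real.exp_nonneg _))
  -- back through `C_ι · C_ιᵀ`
  have hcov := abs_sandwichS_le (ι := ι) (M := M) (hS := hS) hL0 (by positivity : (0 : ℝ) ≤ (γ / 4)⁻¹) hκ'.le hX p q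
  have e : covCS L M ι S hS (deltaPol M n ⊗ₖ (1 : Matrix ι ι ℝ) + P) = elimCS L M ι S hS * ((elimCS L M ι S hS)ᵀ * (deltaPol M n ⊗ₖ (1 : Matrix ι ι ℝ) + P) * elimCS L M ι S hS)⁻¹ * (elimCS L M ι S hS)ᵀ := rfl
  rw [e]
  refine hcov.trans (mul_le_mul_of_nonneg_right (by linarith) (Real.exp_nonneg _))

end Decay

end Summit.QuantumFields.YangMills.BalabanUVNodes.N15.UnitLayerBgCol

end
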